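import Literature.AlgebraicGeometry.HodgeTheory.FermatHodgeConjectureAokiProofs
import Literature.AlgebraicGeometry.HodgeTheory.FermatClaimShiodaSpine
import Literature.AlgebraicGeometry.HodgeTheory.FermatClaimPairedCancellation
import HarnessLib

/-!
# The lattice criterion for Aoki's claim: stub `stub_latticeCriterion` of line `cancel-by-any-claim-lattice`

Route `PadicSemiregularLift` of `HodgeConjecture`, crux `HodgeFermatVarieties`
(stmt-HodgeConjecture-1334: the Hodge conjecture for every complex Fermat hypersurface
`Xⁿₘ : Σ xᵢᵐ = 0 ⊂ ℙⁿ⁺¹`). The line reduces the crux to Aoki's claim(α) ("`V(α)` is generated by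
the classes of algebraic cycles") for every Hodge character `α`, and organises claim by
ℤ-REACHABILITY of the multiset of values of `α` from a family of claimed Hodge multisets closed under
negation (the printed supply). This file proves the LEVER of the line (stub S1), the

**Lattice criterion.** Granted Aoki 1987 Thm 1-4 (i) (juxtaposition, the tree's named fact
`Aoki1987_claim_juxtaposition`) and Thm 1-4 (ii) (pair cancellation,
`Aoki1987_claim_of_claim_juxtaposition_paired`) — both taken here as ANTECEDENTS, nothing is
assumed — let `D` be a family of non-empty Hodge multisets of level `M`, each of which is claimed
together with its negation. If `s ≠ 0` is a Hodge multiset and `s + ΣN = ΣP` as multisets for finite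
families `P, N ⊆ D`, then `claim(s)` (`FermatCharacter.ClaimMultiset M s`).

Proof (Aoki, J. Math. Soc. Japan 39 (1987), Thm 1-4 (i)+(ii), p. 388, read as a statement about
the GROUP generated by the claimed characters): put `T := ΣN` and `δ := T + (−T)`. Then
`s + δ = ΣP + Σ_{u ∈ N} (−u)` as multisets; the right-hand side is a juxtaposition of non-empty
claimed Hodge multisets (the negation of a Hodge multiset is a Hodge multiset, and `−u` is claimed
by the hypothesis on `D`), hence claimed by iterating (i) (`ClaimMultiset.star_of_juxtaposition`).
Realise `s` by a Hodge character `α` of `X²ʳₘ` and `δ` by the literal paired character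
`pairs b = (b₀, …, b_j, −b₀, …, −b_j)` of an enumeration `b` of `T` (all `bₖ ≠ 0`: `T` is a Hodge
multiset); the juxtaposition `append α (pairs b)` has multiset of values `s + δ`, so it is claimed,
and (ii) cancels the pairs (`Aoki1987_claim_of_claim_juxtaposition_paired.literal`): claim(α).
The case `ΣN = 0` is plain iteration of (i) (`s = ΣP`, and `P ≠ ∅` because `s ≠ 0`).

References: [Aoki1987] N. Aoki, Some new algebraic cycles on Fermat varieties, J. Math. Soc. Japan
39 (1987) 385–396, Thm 1-4 (p. 388); [Shioda1979PJA] T. Shioda, Proc. Japan Acad. 55A (1979)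
111–114, §1 (the semigroup `Mₘ`).
-/

set_option linter.dupNamespace false

noncomputable section

open CategoryTheory AlgebraicGeometry Finset
open Literature.AlgebraicGeometry Literature.AlgebraicGeometry.Motives
open Literature.AlgebraicGeometry.HodgeTheory Literature.AlgebraicGeometry.HodgeTheory.FermatCharacter
open Literature.AlgebraicTopology.SingularHomology

namespace Summit.HodgeConjecture.HodgeConjecture.Theorems.CancelByAnyClaimLattice

variable {M : ℕ}

/-! ### Multiset bookkeeping -/

/-- **The negation `−u` of a Hodge multiset `u` is a Hodge multiset** (realise `u` by a Hodge
character `α`; `−α` is a Hodge character, `IsHodge.neg`, with multiset of values `−u`).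
[cite: Shioda1979PJA, §1 (the semigroup Mₘ)] -/
theorem latticeCriterion_isHodgeMultiset_map_neg [NeZero M] {u : Multiset (ZMod M)}
    (hu : IsHodgeMultiset u) : IsHodgeMultiset (u.map fun a ↦ -a) := by
  obtain ⟨k, α, hα, rfl⟩ := hu.exists_isHodge
  have h := hα.neg.isHodgeMultiset
  rwa [show (univ.val.map (-α) : Multiset (ZMod M)) = (univ.val.map α).map (fun a ↦ -a) by
    rw [Multiset.map_map]; rfl] at h

/-- A sum of Hodge multisets is a Hodge multiset (`Mₘ ∪ {0}` is a semigroup).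
[cite: Shioda1979PJA, §1 (the semigroup Mₘ)] -/
theorem latticeCriterion_isHodgeMultiset_sum {Q : Multiset (Multiset (ZMod M))}
    (hQ : ∀ u ∈ Q, IsHodgeMultiset u) : IsHodgeMultiset Q.sum := by
  induction Q using Multiset.induction_on with
  | empty => rw [Multiset.sum_zero]; exact IsHodgeMultiset.zero
  | cons a Q ih =>
    rw [Multiset.sum_cons]
    exact (hQ a (Multiset.mem_cons_self a Q)).add (ih fun u hu ↦ hQ u (Multiset.mem_cons_of_mem hu))

/-- A non-empty sum of non-empty multisets is non-empty. [folklore] -/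
theorem latticeCriterion_sum_ne_zero {Q : Multiset (Multiset (ZMod M))} (hQ : ∀ u ∈ Q, u ≠ 0)
    (hQ0 : Q ≠ 0) : Q.sum ≠ 0 := by
  obtain ⟨a, ha⟩ := Multiset.exists_mem_of_ne_zero hQ0
  obtain ⟨Q, rfl⟩ := Multiset.exists_cons_of_mem ha
  rw [Multiset.sum_cons]
  intro h
  exact hQ a ha (Multiset.le_zero.1 (h ▸ Multiset.le_add_right a Q.sum))

/-- Negation commutes with sums of multisets: `−(ΣN) = Σ_{u ∈ N} (−u)`. [folklore] -/
theorem latticeCriterion_map_neg_sum (N : Multiset (Multiset (ZMod M))) :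
    N.sum.map (fun a ↦ -a) = (N.map fun u ↦ u.map fun a ↦ -a).sum := by
  induction N using Multiset.induction_on with
  | empty => simp
  | cons a N ih =>
    rw [Multiset.sum_cons, Multiset.map_add, Multiset.map_cons, Multiset.sum_cons, ih]

/-! ### Iterating Thm 1-4 (i) -/

/-- **Iterated juxtaposition**: granted Aoki 1987 Thm 1-4 (i), a non-empty sum of non-empty claimed
Hodge multisets is claimed (induction on the number of summands, `ClaimMultiset.star_of_juxtaposition`
at each step; the running sum is a non-empty Hodge multiset). [cite: Aoki1987, Thm. 1-4 (i), p. 388] -/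
theorem latticeCriterion_claimMultiset_sum [NeZero M] (hJ : Aoki1987_claim_juxtaposition)
    {Q : Multiset (Multiset (ZMod M))}
    (hQ : ∀ u ∈ Q, u ≠ 0 ∧ IsHodgeMultiset u ∧ ClaimMultiset M u) (hQ0 : Q ≠ 0) :
    ClaimMultiset M Q.sum := by
  induction Q using Multiset.induction_on with
  | empty => exact absurd rfl hQ0
  | cons a Q ih =>
    have ha := hQ a (Multiset.mem_cons_self a Q)
    have hQ' : ∀ u ∈ Q, u ≠ 0 ∧ IsHodgeMultiset u ∧ ClaimMultiset M u :=
      fun u hu ↦ hQ u (Multiset.mem_cons_of_mem hu)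
    rw [Multiset.sum_cons]
    by_cases h0 : Q = 0
    · subst h0
      rw [Multiset.sum_zero, add_zero]
      exact ha.2.2
    · exact ClaimMultiset.star_of_juxtaposition hJ ha.1
        (latticeCriterion_sum_ne_zero (fun u hu ↦ (hQ' u hu).1) h0) ha.2.1
        (latticeCriterion_isHodgeMultiset_sum fun u hu ↦ (hQ' u hu).2.1) ha.2.2 (ih hQ' h0)

/-! ### The lattice criterion -/

/-- **S1 `stub_latticeCriterion` — THE LEVER of line `cancel-by-any-claim-lattice`: ℤ-reachability
from claimed characters implies claim.** Granted Aoki 1987 Thm 1-4 (i) (`Aoki1987_claim_juxtaposition`)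
and (ii) (`Aoki1987_claim_of_claim_juxtaposition_paired`) as antecedents: for every level `M ≥ 1` and
every family `D` of non-empty Hodge multisets each claimed together with its negation, every Hodge
multiset `s ≠ 0` with `s + ΣN = ΣP` for finite families `P, N ⊆ D` is claimed. Proof: with `T := ΣN`,
`s + (T + (−T)) = ΣP + Σ_{u ∈ N}(−u)` is claimed by iterating (i); realise `s` by a Hodge character
`α` and `T + (−T)` by the paired character `pairs b` of an enumeration `b` of `T`; then
claim(`α ∗ pairs b`), and (ii) cancels the pairs. (`ΣN = 0`: `s = ΣP`, plain iteration of (i).)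
[cite: Aoki1987, Thm. 1-4 (i) and (ii), p. 388] [cite: Shioda1979PJA, §1 (the semigroup Mₘ)] -/
theorem stub_latticeCriterion :
    Aoki1987_claim_juxtaposition → Aoki1987_claim_of_claim_juxtaposition_paired →
    ∀ (M : ℕ) [NeZero M] (D : Set (Multiset (ZMod M))),
      (∀ u ∈ D, u ≠ 0 ∧ IsHodgeMultiset u ∧ ClaimMultiset M u ∧
        ClaimMultiset M (u.map fun a ↦ -a)) →
      ∀ (s : Multiset (ZMod M)) (P N : Multiset (Multiset (ZMod M))),
        s ≠ 0 → IsHodgeMultiset s → (∀ u ∈ P, u ∈ D) → (∀ u ∈ N, u ∈ D) → s + N.sum = P.sum →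
        ClaimMultiset M s := by
  intro hJ hC M _ D hD s P N hs0 hs hP hN heq
  -- every element of `P` is a non-empty claimed Hodge multiset, and `P ≠ ∅` since `s ≠ 0`
  have hP' : ∀ u ∈ P, u ≠ 0 ∧ IsHodgeMultiset u ∧ ClaimMultiset M u :=
    fun u hu ↦ ⟨(hD u (hP u hu)).1, (hD u (hP u hu)).2.1, (hD u (hP u hu)).2.2.1⟩
  have hP0 : P ≠ 0 := by
    rintro rfl
    rw [Multiset.sum_zero] at heq
    exact hs0 (Multiset.le_zero.1 (heq ▸ Multiset.le_add_right s N.sum))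
  by_cases hT0 : N.sum = 0
  · -- no negative part: `s = ΣP` is an iterated juxtaposition
    rw [hT0, add_zero] at heq
    rw [heq]
    exact latticeCriterion_claimMultiset_sum hJ hP' hP0
  · -- `T := ΣN ≠ 0` is a Hodge multiset
    have hTH : IsHodgeMultiset N.sum :=
      latticeCriterion_isHodgeMultiset_sum fun u hu ↦ (hD u (hN u hu)).2.1
    -- `ΣP + Σ_{u ∈ N} (−u)` is a non-empty juxtaposition of non-empty claimed Hodge multisets
    have hQ : ∀ u ∈ P + N.map (fun u ↦ u.map fun a ↦ -a),
        u ≠ 0 ∧ IsHodgeMultiset u ∧ ClaimMultiset M u := by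
      intro u hu
      rcases Multiset.mem_add.1 hu with hu | hu
      · exact hP' u hu
      · obtain ⟨v, hv, rfl⟩ := Multiset.mem_map.1 hu
        have hvD := hD v (hN v hv)
        exact ⟨fun h ↦ hvD.1 (Multiset.map_eq_zero.1 h),
          latticeCriterion_isHodgeMultiset_map_neg hvD.2.1, hvD.2.2.2⟩
    have hQ0 : P + N.map (fun u ↦ u.map fun a ↦ -a) ≠ 0 :=
      fun h ↦ hP0 (Multiset.le_zero.1 (h ▸ Multiset.le_add_right _ _))
    -- hence `s + (T + (−T)) = ΣP + Σ(−u)` is claimed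
    have hclaim : ClaimMultiset M (s + (N.sum + N.sum.map fun a ↦ -a)) := by
      have h := latticeCriterion_claimMultiset_sum hJ hQ hQ0
      rwa [Multiset.sum_add, ← heq, ← latticeCriterion_map_neg_sum, add_assoc] at h
    -- realise `s` by a Hodge character `α`, `T + (−T)` by `pairs b`, and cancel the pairs by (ii)
    intro r α hα
    have hαH : IsHodge α := (isHodge_iff_isHodgeMultiset α).2 (hα ▸ hs)
    obtain ⟨j', b, hb⟩ := exists_eq_univ_val_map N.sum
    obtain ⟨j, rfl⟩ : ∃ j, j' = j + 1 := by
      refine ⟨j' - 1, ?_⟩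
      have hc : Multiset.card N.sum = j' := by rw [← hb, card_univ_val_map]
      have hc0 : Multiset.card N.sum ≠ 0 := fun h ↦ hT0 (Multiset.card_eq_zero.1 h)
      omega
    have hb0 : ∀ k, b k ≠ 0 := fun k ↦
      hTH.1.1 (b k) (hb ▸ Multiset.mem_map_of_mem _ (Finset.mem_univ_val k))
    refine Aoki1987_claim_of_claim_juxtaposition_paired.literal hC M r j α b hαH hb0
      (hclaim.claim ?_)
    rw [univ_val_map_append, univ_val_map_pairs, hα, ← hb, Multiset.map_map]
    rfl

end Summit.HodgeConjecture.HodgeConjecture.Theorems.CancelByAnyClaimLattice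

end
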